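import Summits.QuantumAdvantage.QuantumAdvantage.Theorems.CubicForrelationNearExactIsExactCubicFormR2PartnerLevelTables
import Summits.QuantumAdvantage.QuantumAdvantage.Theorems.CubicForrelationNearExactIsExactCubicFormR2PartnerWlog
import Summits.QuantumAdvantage.QuantumAdvantage.Theorems.CubicForrelationNearExactIsExactCubicFormR2LevelTwoCells
import Summits.QuantumAdvantage.QuantumAdvantage.Theorems.CubicForrelationNearExactIsExactCubicFormLightStructureMu2
import Summits.QuantumAdvantage.QuantumAdvantage.Theorems.CubicForrelationNearExactIsExactCubicFormLightRows
import Summits.QuantumAdvantage.QuantumAdvantage.Theorems.CubicForrelationNearExactIsExactTwelvePartnerR2LeafW4a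
import Summits.QuantumAdvantage.QuantumAdvantage.Theorems.CubicForrelationNearExactIsExactTwelvePartnerR2LeafW4b

/-!
SPLIT (cert seat g43, for the 400-line rule): this is PART 1 — the ordered-neighbour form `tpw_R2_level_two_ordered`; part 2 (…CubicFormR2LevelTwo) derives `tpw_R2_level_two`.
# Crux `CubicForrelation.NearExactIsExact` (stmt-QuantumAdvantage-14043) — E1280-even, R2 branch: LEVEL `h = 2` (descendant `s₀ω₄`,
  light cell of weight `96`) END-TO-END — the LAST R2 endgame

Certificate seat `b2b-cforr-cert` (gen 42).  HONEST FRAMING: kernel-checked assembly (standard axioms) of the `s₀ω₄` endgame (R2-PARTNER §4(ω₄),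
E1280-HANDPROOFS §1.5–1.6, cell lemma L2 with `μ = 2`).  Light cell `C₀₀` of weight `96` with cubic form `s₀∧ω₄` in normal coordinates
(hypothesis `H2` of …CubicFormR2LowAssembly); WLOG `w(C₁₀) ≤ w(C₀₁)` (swap `y₁ ↔ y₂`, `tpw_R2_yframe_transport`); every cell weighs `≥ 96`
(`tl2_cell_eight_lb`).  If BOTH neighbours weigh `< 160`, `tls_light_structure_mu2` (part 2) makes both mixed slices `ε·ω₄ ⊕ D` with `D ≡ 0`
or rank 2 supported on `P` — either way the `F′`-rows of `G` and `Γ` are `[s = z₀]·g`, and the leaf `tpa_R2_w4b` (rank count) ends it.  Else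
`w(C₀₁) ≥ 160` forces `w(C₁₀) < 128`, the exact-neighbour lemma `tpw_light_structure_mu2_lt128` makes `G|_H = ε·ω₄` pure, `tls_light_structure_mu2`
(part 1, `w(C₀₁) < 192`) gives `Γ|_H = ε'·ω₄ ⊕ D′` with `D′ ≡ 0` or `m∧m′`, and the leaf `tpa_R2_w4a` (dual bases) ends it.  It discharges
`H2` of `theta_twelve_eq_57_64_of_two`.  NOT summit progress.

* `tpw_R2_level_two_ordered`, `tpw_R2_level_two` (`H2`).
-/

set_option linter.dupNamespace false -- D-0017: single-problem summit ⇒ `QuantumAdvantage.QuantumAdvantage` by design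

namespace Summit.QuantumAdvantage.QuantumAdvantage.Theorems.CubicForrelation.NearExactIsExact

open Finset
open Literature.Computability.QuantumComplexity
open Literature.Computability.QuantumComplexity.BuzetChailloux (bxor zeroVec bxor_comm bxor_self bxor_zeroVec zeroVec_bxor
  bxor_bxor_cancel_left)

/-- **Level `h = 2` (`s₀ω₄`), light cell `C₀₀`, ordered neighbours.** [this work] -/
theorem tpw_R2_level_two_ordered (hk : 1 + 2 + 2 ≤ 9) (κ : (Fin (3 + 9) → Bool) → Bool) (hκ : IsDegLeFun 3 κ)
    (c d : Fin (3 + 9) → Fin (3 + 9) → Fin (3 + 9) → ZMod 2)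
    (hcs : ∀ p j k, c p k j = c p j k) (hcc : ∀ p j k, c j p k = c p j k) (hcd : ∀ p j, c p j j = 0)
    (hds : ∀ φ j k, d φ k j = d φ j k) (hdc : ∀ φ j k, d j φ k = d φ j k) (hdd : ∀ φ j, d φ j j = 0)
    (hd : ∀ φ j k, d φ j k =
      if ((((κ zeroVec ^^ κ (bxor zeroVec (fun l => decide (l = k)))) ^^
            (κ (bxor zeroVec (fun l => decide (l = j))) ^^ κ (bxor (bxor zeroVec (fun l => decide (l = j))) (fun l => decide (l = k))))) ^^
          ((κ (bxor zeroVec (fun l => decide (l = φ))) ^^ κ (bxor (bxor zeroVec (fun l => decide (l = φ))) (fun l => decide (l = k)))) ^^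
            (κ (bxor (bxor zeroVec (fun l => decide (l = φ))) (fun l => decide (l = j))) ^^
              κ (bxor (bxor (bxor zeroVec (fun l => decide (l = φ))) (fun l => decide (l = j))) (fun l => decide (l = k))))))) = true
      then 1 else 0)
    (hpair : ∀ p φ, (∑ j, ∑ k, (if j < k then c p j k * d φ j k else 0)) = if p = φ then 1 else 0)
    (hD0 : ∀ y, (κ y ^^ κ (bxor y (fun l => decide (l = Fin.castAdd 9 (0 : Fin 3))))) =
      (y (Fin.castAdd 9 (1 : Fin 3)) && y (Fin.castAdd 9 (2 : Fin 3))))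
    (hF1 : ∀ j k, d (Fin.castAdd 9 0) j k =
      if (j = Fin.castAdd 9 1 ∧ k = Fin.castAdd 9 2) ∨ (j = Fin.castAdd 9 2 ∧ k = Fin.castAdd 9 1) then 1 else 0)
    (hsum : #(univ.filter fun s : Fin 9 → Bool => κ (Fin.append ![false, false, false] s) = true) +
      #(univ.filter fun s : Fin 9 → Bool => κ (Fin.append ![false, false, true] s) = true) +
      #(univ.filter fun s : Fin 9 → Bool => κ (Fin.append ![false, true, false] s) = true) < 384)
    (hwt : 4 * #(univ.filter fun s : Fin 9 → Bool => κ (Fin.append ![false, false, false] s) = true) + 2 ^ (9 - 2) = 2 ^ 9)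
    (bz : Bool) (hsupp : ∀ s : Fin 9 → Bool, κ (Fin.append ![false, false, false] s) = true →
      s (Fin.castLE hk (Fin.castAdd 2 (Fin.castAdd 2 (0 : Fin 1)))) = bz)
    (hT : (∀ u v w x : Fin 9 → Bool,
      ((((κ (Fin.append ![false, false, false] x) ^^ κ (Fin.append ![false, false, false] (bxor x w))) ^^
              (κ (Fin.append ![false, false, false] (bxor x v)) ^^ κ (Fin.append ![false, false, false] (bxor (bxor x v) w)))) ^^
            ((κ (Fin.append ![false, false, false] (bxor x u)) ^^ κ (Fin.append ![false, false, false] (bxor (bxor x u) w))) ^^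
              (κ (Fin.append ![false, false, false] (bxor (bxor x u) v)) ^^
                κ (Fin.append ![false, false, false] (bxor (bxor (bxor x u) v) w)))))) =
      ((((u (Fin.castLE hk (Fin.castAdd 2 (Fin.castAdd 2 (0 : Fin 1)))) &&
            decide ((∑ ii : Fin 2, ((if v (Fin.castLE hk (Fin.castAdd 2 (Fin.natAdd 1 ii))) = true then (1 : ZMod 2) else 0) * (if w (Fin.castLE hk (Fin.natAdd (1 + 2) ii)) = true then (1 : ZMod 2) else 0) +
              (if v (Fin.castLE hk (Fin.natAdd (1 + 2) ii)) = true then (1 : ZMod 2) else 0) * (if w (Fin.castLE hk (Fin.castAdd 2 (Fin.natAdd 1 ii))) = true then (1 : ZMod 2) else 0))) = 1)) ^^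
          (v (Fin.castLE hk (Fin.castAdd 2 (Fin.castAdd 2 (0 : Fin 1)))) &&
            decide ((∑ ii : Fin 2, ((if u (Fin.castLE hk (Fin.castAdd 2 (Fin.natAdd 1 ii))) = true then (1 : ZMod 2) else 0) * (if w (Fin.castLE hk (Fin.natAdd (1 + 2) ii)) = true then (1 : ZMod 2) else 0) +
              (if u (Fin.castLE hk (Fin.natAdd (1 + 2) ii)) = true then (1 : ZMod 2) else 0) * (if w (Fin.castLE hk (Fin.castAdd 2 (Fin.natAdd 1 ii))) = true then (1 : ZMod 2) else 0))) = 1))) ^^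
          (w (Fin.castLE hk (Fin.castAdd 2 (Fin.castAdd 2 (0 : Fin 1)))) &&
            decide ((∑ ii : Fin 2, ((if u (Fin.castLE hk (Fin.castAdd 2 (Fin.natAdd 1 ii))) = true then (1 : ZMod 2) else 0) * (if v (Fin.castLE hk (Fin.natAdd (1 + 2) ii)) = true then (1 : ZMod 2) else 0) +
              (if u (Fin.castLE hk (Fin.natAdd (1 + 2) ii)) = true then (1 : ZMod 2) else 0) * (if v (Fin.castLE hk (Fin.castAdd 2 (Fin.natAdd 1 ii))) = true then (1 : ZMod 2) else 0))) = 1))))))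
    (hle : #(univ.filter fun s : Fin 9 → Bool => κ (Fin.append ![false, true, false] s) = true) ≤
      #(univ.filter fun s : Fin 9 → Bool => κ (Fin.append ![false, false, true] s) = true)) : False := by
  obtain ⟨lo, hi, hloi, hhii, hlohi, hlov, hhiv, hT8, t0, tlo, thi⟩ := tpw_R2_level_tables κ hκ d hd hD0 false false 2 hk hT
  obtain ⟨-, htb, -⟩ := tpw_R2_cells κ hκ d hd hD0
  have hW0 : #(univ.filter fun s : Fin 9 → Bool => κ (Fin.append ![false, false, false] s) = true) = 96 := by
    norm_num at hwt; omega
  have hTv : ∀ (vv : Fin 3 → Bool) (u v w x : Fin (1 + 8) → Bool),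
      ((((κ (Fin.append vv x) ^^ κ (Fin.append vv (bxor x w))) ^^
            (κ (Fin.append vv (bxor x v)) ^^ κ (Fin.append vv (bxor (bxor x v) w)))) ^^
          ((κ (Fin.append vv (bxor x u)) ^^ κ (Fin.append vv (bxor (bxor x u) w))) ^^
            (κ (Fin.append vv (bxor (bxor x u) v)) ^^
              κ (Fin.append vv (bxor (bxor (bxor x u) v) w)))))) =
      ((((u (Fin.castAdd 8 (0 : Fin 1)) &&
            decide ((∑ ii : Fin 2, ((if (fun jj => v (Fin.natAdd 1 jj)) (lo ii) = true then (1 : ZMod 2) else 0) * (if (fun jj => w (Fin.natAdd 1 jj)) (hi ii) = true then (1 : ZMod 2) else 0) +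
              (if (fun jj => v (Fin.natAdd 1 jj)) (hi ii) = true then (1 : ZMod 2) else 0) * (if (fun jj => w (Fin.natAdd 1 jj)) (lo ii) = true then (1 : ZMod 2) else 0))) = 1)) ^^
          (v (Fin.castAdd 8 (0 : Fin 1)) &&
            decide ((∑ ii : Fin 2, ((if (fun jj => u (Fin.natAdd 1 jj)) (lo ii) = true then (1 : ZMod 2) else 0) * (if (fun jj => w (Fin.natAdd 1 jj)) (hi ii) = true then (1 : ZMod 2) else 0) +
              (if (fun jj => u (Fin.natAdd 1 jj)) (hi ii) = true then (1 : ZMod 2) else 0) * (if (fun jj => w (Fin.natAdd 1 jj)) (lo ii) = true then (1 : ZMod 2) else 0))) = 1))) ^^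
          (w (Fin.castAdd 8 (0 : Fin 1)) &&
            decide ((∑ ii : Fin 2, ((if (fun jj => u (Fin.natAdd 1 jj)) (lo ii) = true then (1 : ZMod 2) else 0) * (if (fun jj => v (Fin.natAdd 1 jj)) (hi ii) = true then (1 : ZMod 2) else 0) +
              (if (fun jj => u (Fin.natAdd 1 jj)) (hi ii) = true then (1 : ZMod 2) else 0) * (if (fun jj => v (Fin.natAdd 1 jj)) (lo ii) = true then (1 : ZMod 2) else 0))) = 1)))) := by
    intro vv u v w x
    have e := tls_cells_third κ hκ vv ![false, false, false] u v w x x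
    dsimp only at e
    rw [e]
    exact hT8 u v w x
  have lb : ∀ vv : Fin 3 → Bool, 128 ≤ #(univ.filter fun s : Fin 9 → Bool => κ (Fin.append vv s) = true) + 2 ^ (7 - 2) := fun vv =>
    tl2_cell_eight_lb (fun s : Fin (1 + 8) → Bool => κ (Fin.append vv s)) 2 (by norm_num) (by norm_num) lo hi hloi hhii hlohi
      (fun a b : Fin 8 → Bool => decide ((∑ ii : Fin 2, ((if a (lo ii) = true then (1 : ZMod 2) else 0) * (if b (hi ii) = true then (1 : ZMod 2) else 0) +
        (if a (hi ii) = true then (1 : ZMod 2) else 0) * (if b (lo ii) = true then (1 : ZMod 2) else 0))) = 1)) (fun _ _ => rfl) (hTv vv)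
  have l1 := lb ![false, true, false]
  have l2 := lb ![false, false, true]
  norm_num at l1 l2
  have hw10 : #(univ.filter fun s : Fin 9 → Bool => κ (Fin.append ![false, true, false] s) = true) < 144 := by omega
  have hw01 : #(univ.filter fun s : Fin 9 → Bool => κ (Fin.append ![false, false, true] s) = true) < 192 := by omega
  have hb1 : bxor ![false, false, false] (fun l => decide (l = (1 : Fin 3))) = ![false, true, false] := by decide
  have hb2 : bxor ![false, false, false] (fun l => decide (l = (2 : Fin 3))) = ![false, false, true] := by decide
  -- half space
  have i0 : (Fin.castLE hk (Fin.castAdd 2 (Fin.castAdd 2 (0 : Fin 1))) : Fin 9) = Fin.castAdd 8 (0 : Fin 1) := Fin.ext (by simp)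
  have hhalf : ∀ s : Fin 8 → Bool, κ (Fin.append ![false, false, false] (Fin.append ![!bz] s)) = false := by
    intro s
    cases hv : κ (Fin.append ![false, false, false] (Fin.append ![!bz] s)) with
    | false => rfl
    | true =>
      exfalso
      have e := hsupp (Fin.append ![!bz] s) hv
      rw [i0, Fin.append_left] at e
      revert e
      cases bz <;> decide
  have hv0 : Fin.append ![false, false, false] (zeroVec : Fin (1 + 8) → Bool) = (zeroVec : Fin (3 + (1 + 8)) → Bool) := by
    funext l
    refine Fin.addCases (fun t => ?_) (fun σ => ?_) l
    · rw [Fin.append_left]; fin_cases t <;> rfl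
    · rw [Fin.append_right]; rfl
  -- mixed slices as entries of `d`
  have hmixd : ∀ (t : Fin 3) (σ τ : Fin 8) (val : Bool),
      ((((κ (Fin.append ![false, false, false] zeroVec) ^^ κ (bxor (Fin.append ![false, false, false] zeroVec) (fun l => decide (l = Fin.natAdd 3 (Fin.natAdd 1 τ))))) ^^
              (κ (bxor (Fin.append ![false, false, false] zeroVec) (fun l => decide (l = Fin.natAdd 3 (Fin.natAdd 1 σ)))) ^^ κ (bxor (bxor (Fin.append ![false, false, false] zeroVec) (fun l => decide (l = Fin.natAdd 3 (Fin.natAdd 1 σ)))) (fun l => decide (l = Fin.natAdd 3 (Fin.natAdd 1 τ)))))) ^^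
            ((κ (bxor (Fin.append ![false, false, false] zeroVec) (fun l => decide (l = Fin.castAdd (1 + 8) t))) ^^ κ (bxor (bxor (Fin.append ![false, false, false] zeroVec) (fun l => decide (l = Fin.castAdd (1 + 8) t))) (fun l => decide (l = Fin.natAdd 3 (Fin.natAdd 1 τ))))) ^^
              (κ (bxor (bxor (Fin.append ![false, false, false] zeroVec) (fun l => decide (l = Fin.castAdd (1 + 8) t))) (fun l => decide (l = Fin.natAdd 3 (Fin.natAdd 1 σ)))) ^^
                κ (bxor (bxor (bxor (Fin.append ![false, false, false] zeroVec) (fun l => decide (l = Fin.castAdd (1 + 8) t))) (fun l => decide (l = Fin.natAdd 3 (Fin.natAdd 1 σ)))) (fun l => decide (l = Fin.natAdd 3 (Fin.natAdd 1 τ)))))))) = val →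
      d (Fin.castAdd (1 + 8) t) (Fin.natAdd 3 (Fin.natAdd 1 σ)) (Fin.natAdd 3 (Fin.natAdd 1 τ)) = if val = true then 1 else 0 := by
    intro t σ τ val e
    rw [hv0] at e
    rw [hd]
    exact congrArg (fun b : Bool => if b = true then (1 : ZMod 2) else 0) e
  -- `ω` at unit vectors is the `z0`-slice
  have hS : ∀ S : ZMod 2, (if decide (S = 1) = true then (1 : ZMod 2) else 0) = S := by decide
  have key2 : ∀ a b c e' : Bool, (a && c) = false →
      ((if (a = true ∧ b = true) ∨ (c = true ∧ e' = true) then (1 : ZMod 2) else 0) =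
        (if a = true then (1 : ZMod 2) else 0) * (if b = true then 1 else 0) + (if c = true then 1 else 0) * (if e' = true then 1 else 0)) := by
    decide
  have hWω : ∀ σ τ : Fin 8, d (Fin.natAdd 3 (Fin.castAdd 8 (0 : Fin 1))) (Fin.natAdd 3 (Fin.natAdd 1 σ)) (Fin.natAdd 3 (Fin.natAdd 1 τ)) =
      if (fun a b : Fin 8 → Bool => decide ((∑ ii : Fin 2, ((if a (lo ii) = true then (1 : ZMod 2) else 0) * (if b (hi ii) = true then (1 : ZMod 2) else 0) +
        (if a (hi ii) = true then (1 : ZMod 2) else 0) * (if b (lo ii) = true then (1 : ZMod 2) else 0))) = 1)) (fun l => decide (l = σ)) (fun l => decide (l = τ)) = true then 1 else 0 := by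
    intro σ τ
    rw [t0]
    dsimp only
    rw [hS]
    refine Finset.sum_congr rfl fun q _ => ?_
    have hac : (decide (lo q = σ) && decide (hi q = σ)) = false := by
      by_cases h1 : lo q = σ
      · have : ¬ hi q = σ := fun h2 => hlohi q q (h1.trans h2.symm)
        simp [this]
      · simp [h1]
    rw [← key2 _ _ _ _ hac]
    simp only [decide_eq_true_eq, Fin.natAdd_inj]
    have hiff : ((σ = lo q ∧ τ = hi q) ∨ (σ = hi q ∧ τ = lo q)) ↔ ((lo q = σ ∧ hi q = τ) ∨ (hi q = σ ∧ lo q = τ)) := by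
      constructor
      · rintro (⟨h1, h2⟩ | ⟨h1, h2⟩)
        · exact Or.inl ⟨h1.symm, h2.symm⟩
        · exact Or.inr ⟨h1.symm, h2.symm⟩
      · rintro (⟨h1, h2⟩ | ⟨h1, h2⟩)
        · exact Or.inl ⟨h1.symm, h2.symm⟩
        · exact Or.inr ⟨h1.symm, h2.symm⟩
    simp only [hiff]
  have hdiag : ∀ φ k, d φ φ k = 0 := fun φ k => (hds φ k φ).trans ((hdc k φ φ).trans (hdd k φ))
  have hsplit : ∀ s : Fin (1 + 8), s ≠ Fin.castAdd 8 (0 : Fin 1) → ∃ σ : Fin 8, s = Fin.natAdd 1 σ := by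
    intro s hs
    have h0 : s.val ≠ 0 := fun h0 => hs (Fin.ext (by simpa using h0))
    exact ⟨⟨s.val - 1, by omega⟩, Fin.ext (by simp; omega)⟩
  -- `ω'` vanishes on the `F′`-unit vectors (coordinates `4..7` of `Fin 8`)
  have hωF : ∀ (φ : Fin 8), 4 ≤ φ.val → ∀ y : Fin 8 → Bool, (fun a b : Fin 8 → Bool => decide ((∑ ii : Fin 2, ((if a (lo ii) = true then (1 : ZMod 2) else 0) * (if b (hi ii) = true then (1 : ZMod 2) else 0) +
        (if a (hi ii) = true then (1 : ZMod 2) else 0) * (if b (lo ii) = true then (1 : ZMod 2) else 0))) = 1)) (fun l => decide (l = φ)) y = false := by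
    intro φ hφ y
    have hl : ∀ ii : Fin 2, decide (lo ii = φ) = false := fun ii => by
      apply decide_eq_false; intro h; have := congrArg Fin.val h; rw [hlov] at this; omega
    have hh : ∀ ii : Fin 2, decide (hi ii = φ) = false := fun ii => by
      apply decide_eq_false; intro h; have := congrArg Fin.val h; rw [hhiv] at this; omega
    simp [hl, hh]
  -- rows of `t̄` through coordinates `≥ 5` vanish
  have hFrow0 : ∀ (a : Fin 9), 5 ≤ a.val → ∀ s t : Fin 9, d (Fin.natAdd 3 a) (Fin.natAdd 3 s) (Fin.natAdd 3 t) = 0 := by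
    intro a ha s t
    rw [htb ![false, false, false] a s t zeroVec]
    have ha0 : decide ((Fin.castAdd 8 (0 : Fin 1) : Fin (1 + 8)) = a) = false := by
      apply decide_eq_false; intro h; have := congrArg Fin.val h; simp at this; omega
    have hal : ∀ ii : Fin 2, decide ((Fin.natAdd 1 (lo ii) : Fin (1 + 8)) = a) = false := fun ii => by
      apply decide_eq_false; intro h; have := congrArg Fin.val h; simp [hlov] at this; omega
    have hah : ∀ ii : Fin 2, decide ((Fin.natAdd 1 (hi ii) : Fin (1 + 8)) = a) = false := fun ii => by
      apply decide_eq_false; intro h; have := congrArg Fin.val h; simp [hhiv] at this; omega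
    have e := hT8 (fun l => decide (l = a)) (fun l => decide (l = s)) (fun l => decide (l = t)) zeroVec
    rw [e]
    simp only [ha0, hal, hah, Bool.false_eq_true, if_false, zero_mul, add_zero, Finset.sum_const_zero,
      show decide ((0 : ZMod 2) = 1) = false from by decide, Bool.false_and, Bool.and_false, Bool.xor_false]
  by_cases h160 : #(univ.filter fun s : Fin 9 → Bool => κ (Fin.append ![false, false, true] s) = true) < 160
  · -- BOTH neighbours light: `tls_light_structure_mu2` part 2 twice, leaf `w4b`
    have hw1' : #(univ.filter fun y : Fin (1 + 8) → Bool =>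
        κ (Fin.append (bxor ![false, false, false] (fun l => decide (l = (1 : Fin 3)))) y) = true) < 160 := by
      rw [hb1]; exact lt_trans hw10 (by norm_num)
    have hw2' : #(univ.filter fun y : Fin (1 + 8) → Bool =>
        κ (Fin.append (bxor ![false, false, false] (fun l => decide (l = (2 : Fin 3)))) y) = true) < 160 := by
      rw [hb2]; exact h160
    obtain ⟨ε₁, D₁, hM₁, -, -, hD₁z⟩ := (tls_light_structure_mu2 κ hκ ![false, false, false] lo hi hloi hhii hlohi
      (fun a b : Fin 8 → Bool => decide ((∑ ii : Fin 2, ((if a (lo ii) = true then (1 : ZMod 2) else 0) * (if b (hi ii) = true then (1 : ZMod 2) else 0) +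
        (if a (hi ii) = true then (1 : ZMod 2) else 0) * (if b (lo ii) = true then (1 : ZMod 2) else 0))) = 1)) (fun _ _ => rfl) hT8 bz hhalf 1).2 hw1'
    obtain ⟨ε₂, D₂, hM₂, -, -, hD₂z⟩ := (tls_light_structure_mu2 κ hκ ![false, false, false] lo hi hloi hhii hlohi
      (fun a b : Fin 8 → Bool => decide ((∑ ii : Fin 2, ((if a (lo ii) = true then (1 : ZMod 2) else 0) * (if b (hi ii) = true then (1 : ZMod 2) else 0) +
        (if a (hi ii) = true then (1 : ZMod 2) else 0) * (if b (lo ii) = true then (1 : ZMod 2) else 0))) = 1)) (fun _ _ => rfl) hT8 bz hhalf 2).2 hw2'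
    -- `D` vanishes on the `F′`-unit vectors
    have hDF : ∀ (D : (Fin 8 → Bool) → (Fin 8 → Bool) → Bool),
        ((∀ x y, D x y = false) ∨ ((∃ p q : Fin 8 → Bool, ∀ x y, D x y = ((D x q && D y p) ^^ (D x p && D y q))) ∧
          (∀ x, (∀ i, x (lo i) = false) → (∀ i, x (hi i) = false) → ∀ y, D x y = false))) →
        ∀ (φ : Fin 8), 4 ≤ φ.val → ∀ y, D (fun l => decide (l = φ)) y = false := by
      intro D hDz φ hφ y
      rcases hDz with h0 | ⟨-, hsup⟩
      · exact h0 _ _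
      · refine hsup _ (fun i => ?_) (fun i => ?_) y
        · apply decide_eq_false; intro h; have := congrArg Fin.val h; rw [hlov] at this; omega
        · apply decide_eq_false; intro h; have := congrArg Fin.val h; rw [hhiv] at this; omega
    have hF5 : ∀ f : Fin 4, (Fin.natAdd 5 f : Fin 9) = Fin.natAdd 1 (⟨4 + f.val, by omega⟩ : Fin 8) := fun f =>
      Fin.ext (by simp; omega)
    have hrow1 : ∀ (t : Fin 3) (ε : Bool) (D : (Fin 8 → Bool) → (Fin 8 → Bool) → Bool),
        (∀ σ τ : Fin 8, ((((κ (Fin.append ![false, false, false] zeroVec) ^^ κ (bxor (Fin.append ![false, false, false] zeroVec) (fun l => decide (l = Fin.natAdd 3 (Fin.natAdd 1 τ))))) ^^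
              (κ (bxor (Fin.append ![false, false, false] zeroVec) (fun l => decide (l = Fin.natAdd 3 (Fin.natAdd 1 σ)))) ^^ κ (bxor (bxor (Fin.append ![false, false, false] zeroVec) (fun l => decide (l = Fin.natAdd 3 (Fin.natAdd 1 σ)))) (fun l => decide (l = Fin.natAdd 3 (Fin.natAdd 1 τ)))))) ^^
            ((κ (bxor (Fin.append ![false, false, false] zeroVec) (fun l => decide (l = Fin.castAdd (1 + 8) t))) ^^ κ (bxor (bxor (Fin.append ![false, false, false] zeroVec) (fun l => decide (l = Fin.castAdd (1 + 8) t))) (fun l => decide (l = Fin.natAdd 3 (Fin.natAdd 1 τ))))) ^^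
              (κ (bxor (bxor (Fin.append ![false, false, false] zeroVec) (fun l => decide (l = Fin.castAdd (1 + 8) t))) (fun l => decide (l = Fin.natAdd 3 (Fin.natAdd 1 σ)))) ^^
                κ (bxor (bxor (bxor (Fin.append ![false, false, false] zeroVec) (fun l => decide (l = Fin.castAdd (1 + 8) t))) (fun l => decide (l = Fin.natAdd 3 (Fin.natAdd 1 σ)))) (fun l => decide (l = Fin.natAdd 3 (Fin.natAdd 1 τ)))))))) =
          ((ε && (fun a b : Fin 8 → Bool => decide ((∑ ii : Fin 2, ((if a (lo ii) = true then (1 : ZMod 2) else 0) * (if b (hi ii) = true then (1 : ZMod 2) else 0) +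
        (if a (hi ii) = true then (1 : ZMod 2) else 0) * (if b (lo ii) = true then (1 : ZMod 2) else 0))) = 1)) (fun l => decide (l = σ)) (fun l => decide (l = τ))) ^^ D (fun l => decide (l = σ)) (fun l => decide (l = τ)))) →
        (∀ (φ : Fin 8), 4 ≤ φ.val → ∀ y, D (fun l => decide (l = φ)) y = false) →
        ∀ (f : Fin 4) (s : Fin (5 + 4)), d (Fin.castAdd 9 t) (Fin.natAdd 3 (Fin.natAdd 5 f)) (Fin.natAdd 3 s) =
          d (Fin.castAdd (1 + 8) t) (Fin.natAdd 3 (Fin.natAdd 5 f)) (Fin.natAdd 3 (Fin.castAdd 8 (0 : Fin 1))) *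
            (if s = Fin.castAdd 8 (0 : Fin 1) then 1 else 0) := by
      intro t ε D hM hDv f s
      by_cases hs : s = Fin.castAdd 8 (0 : Fin 1)
      · rw [if_pos hs, mul_one, hs]
      · obtain ⟨σ, rfl⟩ := hsplit s hs
        rw [if_neg hs, mul_zero, hF5]
        show d (Fin.castAdd (1 + 8) t) _ _ = 0
        rw [hmixd t _ σ _ (hM _ σ)]
        have h1 := hωF ⟨4 + f.val, by omega⟩ (by simp) (fun l => decide (l = σ))
        have h2 := hDv ⟨4 + f.val, by omega⟩ (by simp) (fun l => decide (l = σ))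
        simp only [] at h1 h2 ⊢
        rw [h1, h2]
        cases ε <;> rfl
    have hGb := hrow1 1 ε₁ D₁ hM₁ (hDF D₁ hD₁z)
    have hΓb := hrow1 2 ε₂ D₂ hM₂ (hDF D₂ hD₂z)
    have htbb : ∀ (f : Fin 4) (s t : Fin (5 + 4)), d (Fin.natAdd 3 (Fin.natAdd 5 f)) (Fin.natAdd 3 s) (Fin.natAdd 3 t) = 0 :=
      fun f s t => hFrow0 (Fin.natAdd 5 f) (by simp) s t
    exact tpa_R2_w4b c d hcs hcc hds hdc hdd hpair hF1 htbb
      (fun f => d (Fin.castAdd (1 + 8) 1) (Fin.natAdd 3 (Fin.natAdd 5 f)) (Fin.natAdd 3 (Fin.castAdd 8 (0 : Fin 1))))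
      (fun f => d (Fin.castAdd (1 + 8) 2) (Fin.natAdd 3 (Fin.natAdd 5 f)) (Fin.natAdd 3 (Fin.castAdd 8 (0 : Fin 1))))
      (fun s => if s = Fin.castAdd 8 (0 : Fin 1) then 1 else 0) (fun s => if s = Fin.castAdd 8 (0 : Fin 1) then 1 else 0) hGb hΓb
  · -- `w(C₀₁) ≥ 160`: then `w(C₁₀) < 128` — the exact neighbour; leaf `w4a`
    have hw10' : #(univ.filter fun y : Fin (1 + 8) → Bool =>
        κ (Fin.append (bxor ![false, false, false] (fun l => decide (l = (1 : Fin 3)))) y) = true) < 128 := by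
      have h' : #(univ.filter fun s : Fin 9 → Bool => κ (Fin.append ![false, true, false] s) = true) < 128 := by omega
      rw [hb1]; exact h'
    have hw2' : #(univ.filter fun y : Fin (1 + 8) → Bool =>
        κ (Fin.append (bxor ![false, false, false] (fun l => decide (l = (2 : Fin 3)))) y) = true) < 192 := by
      rw [hb2]; exact hw01
    obtain ⟨ε₁, hε₁⟩ := tpw_light_structure_mu2_lt128 κ hκ ![false, false, false] lo hi hloi hhii hlohi
      (fun a b : Fin 8 → Bool => decide ((∑ ii : Fin 2, ((if a (lo ii) = true then (1 : ZMod 2) else 0) * (if b (hi ii) = true then (1 : ZMod 2) else 0) +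
        (if a (hi ii) = true then (1 : ZMod 2) else 0) * (if b (lo ii) = true then (1 : ZMod 2) else 0))) = 1)) (fun _ _ => rfl) hT8 bz hhalf 1 hw10'
    obtain ⟨ε₂, D₂, hM₂, hD₂s, hD₂a, hD₂z⟩ := (tls_light_structure_mu2 κ hκ ![false, false, false] lo hi hloi hhii hlohi
      (fun a b : Fin 8 → Bool => decide ((∑ ii : Fin 2, ((if a (lo ii) = true then (1 : ZMod 2) else 0) * (if b (hi ii) = true then (1 : ZMod 2) else 0) +
        (if a (hi ii) = true then (1 : ZMod 2) else 0) * (if b (lo ii) = true then (1 : ZMod 2) else 0))) = 1)) (fun _ _ => rfl) hT8 bz hhalf 2).1 hw2'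
    -- `G` in leaf format (light rows)
    have hGmix : ∀ σ τ : Fin 8, d (Fin.castAdd (1 + 8) 1) (Fin.natAdd 3 (Fin.natAdd 1 σ)) (Fin.natAdd 3 (Fin.natAdd 1 τ)) =
        if (ε₁ && (fun a b : Fin 8 → Bool => decide ((∑ ii : Fin 2, ((if a (lo ii) = true then (1 : ZMod 2) else 0) * (if b (hi ii) = true then (1 : ZMod 2) else 0) +
        (if a (hi ii) = true then (1 : ZMod 2) else 0) * (if b (lo ii) = true then (1 : ZMod 2) else 0))) = 1)) (fun l => decide (l = σ)) (fun l => decide (l = τ))) = true then 1 else 0 :=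
      fun σ τ => hmixd 1 σ τ _ (hε₁ σ τ)
    have hG : ∀ s u : Fin (1 + 8), d (Fin.castAdd (1 + 8) 1) (Fin.natAdd 3 s) (Fin.natAdd 3 u) =
        (if ε₁ = true then (1 : ZMod 2) else 0) * d (Fin.natAdd 3 (Fin.castAdd 8 (0 : Fin 1))) (Fin.natAdd 3 s) (Fin.natAdd 3 u) +
        (if s = Fin.castAdd 8 (0 : Fin 1) then d (Fin.castAdd (1 + 8) 1) (Fin.natAdd 3 (Fin.castAdd 8 (0 : Fin 1))) (Fin.natAdd 3 u) else 0) +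
        (if u = Fin.castAdd 8 (0 : Fin 1) then d (Fin.castAdd (1 + 8) 1) (Fin.natAdd 3 (Fin.castAdd 8 (0 : Fin 1))) (Fin.natAdd 3 s) else 0) := by
      refine tlg_light_rows (fun s u => d (Fin.castAdd (1 + 8) 1) (Fin.natAdd 3 s) (Fin.natAdd 3 u))
        (fun s u => d (Fin.natAdd 3 (Fin.castAdd 8 (0 : Fin 1))) (Fin.natAdd 3 s) (Fin.natAdd 3 u)) (Fin.castAdd 8 (0 : Fin 1))
        (if ε₁ = true then (1 : ZMod 2) else 0) (fun s u => hds _ _ _) (hdd _ _) (fun u => hdiag _ _) (fun s => ?_) (fun s u hs hu => ?_)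
      · show d _ _ _ = 0
        rw [hds]; exact hdiag _ _
      · obtain ⟨σ, rfl⟩ := hsplit s hs
        obtain ⟨τ, rfl⟩ := hsplit u hu
        show d _ _ _ = _ * d _ _ _
        rw [hGmix, hWω, tlg_ite_and]
    -- `Γ` in leaf format (light rows plus the rank-2 term)
    have hD0v : ∀ y, D₂ zeroVec y = false := fun y => by
      have e := hD₂a zeroVec zeroVec y
      rw [bxor_self] at e
      revert e; cases D₂ zeroVec y <;> decide
    obtain ⟨m, m', hm0, hm0', hmm⟩ : ∃ m m' : Fin (1 + 8) → ZMod 2, m (Fin.castAdd 8 (0 : Fin 1)) = 0 ∧ m' (Fin.castAdd 8 (0 : Fin 1)) = 0 ∧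
        ∀ σ τ : Fin 8, (if D₂ (fun l => decide (l = σ)) (fun l => decide (l = τ)) = true then (1 : ZMod 2) else 0) =
          m (Fin.natAdd 1 σ) * m' (Fin.natAdd 1 τ) + m' (Fin.natAdd 1 σ) * m (Fin.natAdd 1 τ) := by
      rcases hD₂z with h0 | ⟨p, q, hpq⟩
      · exact ⟨fun _ => 0, fun _ => 0, rfl, rfl, fun σ τ => by rw [h0]; simp⟩
      · have hxor2 : ∀ a b c e' : Bool, (if ((a && b) ^^ (c && e')) = true then (1 : ZMod 2) else 0) =
            (if a = true then 1 else 0) * (if b = true then 1 else 0) + (if c = true then 1 else 0) * (if e' = true then 1 else 0) := by decide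
        have hne : ∀ σ : Fin 8, (Fin.natAdd 1 σ : Fin (1 + 8)) ≠ Fin.castAdd 8 (0 : Fin 1) := fun σ h => by
          have := congrArg Fin.val h; simp at this
        refine ⟨fun s => if h : s = Fin.castAdd 8 (0 : Fin 1) then 0 else
            if D₂ (fun l => decide (l = Classical.choose (hsplit s h))) q = true then 1 else 0,
          fun s => if h : s = Fin.castAdd 8 (0 : Fin 1) then 0 else
            if D₂ (fun l => decide (l = Classical.choose (hsplit s h))) p = true then 1 else 0,
          by simp, by simp, fun σ τ => ?_⟩
        have hcs' : ∀ σ : Fin 8, Classical.choose (hsplit (Fin.natAdd 1 σ) (hne σ)) = σ := fun σ =>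
          ((Fin.natAdd_inj 1).mp (Classical.choose_spec (hsplit (Fin.natAdd 1 σ) (hne σ)))).symm
        simp only [dif_neg (hne σ), dif_neg (hne τ), hcs']
        rw [hpq, hxor2]
    have hΓ : ∀ s u : Fin (1 + 8), d (Fin.castAdd (1 + 8) 2) (Fin.natAdd 3 s) (Fin.natAdd 3 u) =
        (if ε₂ = true then (1 : ZMod 2) else 0) * d (Fin.natAdd 3 (Fin.castAdd 8 (0 : Fin 1))) (Fin.natAdd 3 s) (Fin.natAdd 3 u) +
        (if s = Fin.castAdd 8 (0 : Fin 1) then d (Fin.castAdd (1 + 8) 2) (Fin.natAdd 3 (Fin.castAdd 8 (0 : Fin 1))) (Fin.natAdd 3 u) else 0) +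
        (if u = Fin.castAdd 8 (0 : Fin 1) then d (Fin.castAdd (1 + 8) 2) (Fin.natAdd 3 (Fin.castAdd 8 (0 : Fin 1))) (Fin.natAdd 3 s) else 0) +
        (m s * m' u + m' s * m u) := by
      have hb3 : ∀ a o dd : Bool, (if ((a && o) ^^ dd) = true then (1 : ZMod 2) else 0) =
          (if a = true then (1 : ZMod 2) else 0) * (if o = true then 1 else 0) + 0 + 0 + (if dd = true then 1 else 0) := by decide
      intro s u
      by_cases hs : s = Fin.castAdd 8 (0 : Fin 1)
      · subst hs
        rw [if_pos (rfl : (Fin.castAdd 8 (0 : Fin 1) : Fin (1 + 8)) = Fin.castAdd 8 0), hm0, hm0',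
          hdiag (Fin.natAdd 3 (Fin.castAdd 8 (0 : Fin 1))) (Fin.natAdd 3 u)]
        by_cases hu : u = Fin.castAdd 8 (0 : Fin 1)
        · rw [if_pos hu, hu, hdd]; ring
        · rw [if_neg hu]; ring
      · by_cases hu : u = Fin.castAdd 8 (0 : Fin 1)
        · subst hu
          rw [if_neg hs, if_pos (rfl : (Fin.castAdd 8 (0 : Fin 1) : Fin (1 + 8)) = Fin.castAdd 8 0), hm0, hm0',
            hds (Fin.castAdd (1 + 8) 2) (Fin.natAdd 3 (Fin.castAdd 8 (0 : Fin 1))) (Fin.natAdd 3 s),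
            hds (Fin.natAdd 3 (Fin.castAdd 8 (0 : Fin 1))) (Fin.natAdd 3 (Fin.castAdd 8 (0 : Fin 1))) (Fin.natAdd 3 s),
            hdiag]
          ring
        · obtain ⟨σ, rfl⟩ := hsplit s hs
          obtain ⟨τ, rfl⟩ := hsplit u hu
          rw [if_neg hs, if_neg hu, hmixd 2 σ τ _ (hM₂ σ τ), hWω, ← hmm σ τ]
          exact hb3 _ _ _
    -- the leaf's coordinates on `Fin (1 + 4 + 4)`
    have hz0 : (Fin.castAdd 4 (Fin.castAdd 4 (0 : Fin 1)) : Fin 9) = Fin.castAdd 8 (0 : Fin 1) := Fin.ext (by simp)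
    have hPlo : ∀ q : Fin 2, (Fin.castAdd 4 (Fin.natAdd 1 (⟨q.val, by omega⟩ : Fin 4)) : Fin 9) = Fin.natAdd 1 (lo q) := fun q =>
      Fin.ext (by simp [hlov])
    have hPhi : ∀ q : Fin 2, (Fin.castAdd 4 (Fin.natAdd 1 (⟨2 + q.val, by omega⟩ : Fin 4)) : Fin 9) = Fin.natAdd 1 (hi q) := fun q =>
      Fin.ext (by simp [hhiv])
    have htbF : ∀ (f : Fin 4) (s t : Fin (1 + 4 + 4)), d (Fin.natAdd 3 (Fin.natAdd (1 + 4) f)) (Fin.natAdd 3 s) (Fin.natAdd 3 t) = 0 :=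
      fun f s t => hFrow0 (Fin.natAdd (1 + 4) f) (by simp) s t
    have htbP : ∀ t : Fin 4, ∃ f : Fin 4, ∀ s u : Fin (1 + 4 + 4),
        d (Fin.natAdd 3 (Fin.castAdd 4 (Fin.natAdd 1 f))) (Fin.natAdd 3 s) (Fin.natAdd 3 u) =
          if (s = Fin.castAdd 4 (Fin.castAdd 4 0) ∧ u = Fin.castAdd 4 (Fin.natAdd 1 t)) ∨
             (u = Fin.castAdd 4 (Fin.castAdd 4 0) ∧ s = Fin.castAdd 4 (Fin.natAdd 1 t)) then 1 else 0 := by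
      intro t
      rcases Nat.lt_or_ge t.val 2 with ht | ht
      · have htq : t = ⟨(⟨t.val, ht⟩ : Fin 2).val, by omega⟩ := Fin.ext rfl
        refine ⟨⟨2 + t.val, by omega⟩, fun s u => ?_⟩
        have e1 := hPhi ⟨t.val, ht⟩
        have e2 := hPlo ⟨t.val, ht⟩
        simp only at e1 e2
        rw [← htq] at e2
        rw [e1, hz0, e2, thi]
        congr 1
        refine propext ⟨?_, ?_⟩
        · rintro (⟨h1, h2⟩ | ⟨h1, h2⟩)
          · exact Or.inl ⟨h1, h2⟩
          · exact Or.inr ⟨h2, h1⟩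
        · rintro (⟨h1, h2⟩ | ⟨h1, h2⟩)
          · exact Or.inl ⟨h1, h2⟩
          · exact Or.inr ⟨h2, h1⟩
      · have htq : t = ⟨2 + (⟨t.val - 2, by omega⟩ : Fin 2).val, by simp; omega⟩ := Fin.ext (by simp; omega)
        refine ⟨⟨t.val - 2, by omega⟩, fun s u => ?_⟩
        have e1 := hPlo ⟨t.val - 2, by omega⟩
        have e2 := hPhi ⟨t.val - 2, by omega⟩
        simp only at e1 e2
        rw [← htq] at e2
        rw [e1, hz0, e2, tlo]
        congr 1
        refine propext ⟨?_, ?_⟩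
        · rintro (⟨h1, h2⟩ | ⟨h1, h2⟩)
          · exact Or.inl ⟨h1, h2⟩
          · exact Or.inr ⟨h2, h1⟩
        · rintro (⟨h1, h2⟩ | ⟨h1, h2⟩)
          · exact Or.inl ⟨h1, h2⟩
          · exact Or.inr ⟨h2, h1⟩
    have hG' : ∀ s t : Fin (1 + 4 + 4), d (Fin.castAdd 9 1) (Fin.natAdd 3 s) (Fin.natAdd 3 t) =
        (if ε₁ = true then (1 : ZMod 2) else 0) * d (Fin.natAdd 3 (Fin.castAdd 4 (Fin.castAdd 4 0))) (Fin.natAdd 3 s) (Fin.natAdd 3 t) +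
          (if s = Fin.castAdd 4 (Fin.castAdd 4 0) then d (Fin.castAdd (1 + 8) 1) (Fin.natAdd 3 (Fin.castAdd 8 (0 : Fin 1))) (Fin.natAdd 3 t) else 0) +
          (if t = Fin.castAdd 4 (Fin.castAdd 4 0) then d (Fin.castAdd (1 + 8) 1) (Fin.natAdd 3 (Fin.castAdd 8 (0 : Fin 1))) (Fin.natAdd 3 s) else 0) := by
      intro s t; rw [hz0]; exact hG s t
    have hΓ' : ∀ s t : Fin (1 + 4 + 4), d (Fin.castAdd 9 2) (Fin.natAdd 3 s) (Fin.natAdd 3 t) =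
        (if ε₂ = true then (1 : ZMod 2) else 0) * d (Fin.natAdd 3 (Fin.castAdd 4 (Fin.castAdd 4 0))) (Fin.natAdd 3 s) (Fin.natAdd 3 t) +
          (if s = Fin.castAdd 4 (Fin.castAdd 4 0) then d (Fin.castAdd (1 + 8) 2) (Fin.natAdd 3 (Fin.castAdd 8 (0 : Fin 1))) (Fin.natAdd 3 t) else 0) +
          (if t = Fin.castAdd 4 (Fin.castAdd 4 0) then d (Fin.castAdd (1 + 8) 2) (Fin.natAdd 3 (Fin.castAdd 8 (0 : Fin 1))) (Fin.natAdd 3 s) else 0) +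
          (m s * m' t + m' s * m t) := by
      intro s t; rw [hz0]; exact hΓ s t
    exact tpa_R2_w4a c d hcs hcc hcd hds hdc hdd hpair hF1 htbF htbP (if ε₁ = true then (1 : ZMod 2) else 0)
      (if ε₂ = true then (1 : ZMod 2) else 0)
      (fun u => d (Fin.castAdd (1 + 8) 1) (Fin.natAdd 3 (Fin.castAdd 8 (0 : Fin 1))) (Fin.natAdd 3 u))
      (fun u => d (Fin.castAdd (1 + 8) 2) (Fin.natAdd 3 (Fin.castAdd 8 (0 : Fin 1))) (Fin.natAdd 3 u)) m m' hG' hΓ'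

end Summit.QuantumAdvantage.QuantumAdvantage.Theorems.CubicForrelation.NearExactIsExact
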